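import Mathlib.Data.Fintype.Perm
import Mathlib.Data.Fintype.Sigma
import Mathlib.Data.Fintype.BigOperators
import Mathlib.Data.Nat.Choose.Bounds
import Mathlib.Analysis.SpecialFunctions.Log.Basic
import Mathlib.Analysis.Complex.ExponentialBounds
import Literature.ModelTheory.FiniteModelTheory.AtseriasDawar3XorProofs
import Literature.Combinatorics.BinomialEntropyBound
import HarnessLib

/-!
# Data for the sparse OR-instances: bounded-degree expanders, far right-hand sides, mixing graphs

Topic `Literature/ModelTheory/FiniteModelTheory`; support file for the discharge of
`LichterPago2025_cohomologyFooled` (`CohomologicalConsistencyLimits.lean`, via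
`SparseOrInstance.lean`).  Four combinatorial existence statements, all PROVED by counting:

1. **Degree splitting** (`SparseOrData.splitScope`): a three-uniform system of scopes
   `F : Fin m → Finset (Fin n)` becomes one on the variables `Σ v, Fin (deg v / D + 1)` (every
   variable split into blocks of at most `D` of its occurrences) with every variable in at most `D`
   scopes, at least as much vertex expansion (`card_biUnion_le_card_biUnion_split`), and at most
   `n + 3m/D` variables.  Combined with the tree's `Xor3Gap.exists_threeUniformExpander`
   (Atserias–Dawar 2019, Lemma 5, by counting) this gives BOUNDED-DEGREE boundary expanders.
2. **Far right-hand sides** (`exists_far`): if `p^{|V|} · p^e · Σ_{i<e} C(m,i) < p^m`, some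
   `b : Fin m → ZMod p` makes EVERY assignment violate at least `e` of the equations
   `∑_{v ∈ S u} x_v = b u` (the Hamming balls of radius `< e` around the `p^{|V|}` vectors `Sx` do
   not cover; volume bound for Hamming balls).  With degrees `≤ D` this yields ROBUST
   UNSATISFIABILITY (`robust_of_far`): every assignment violates an equation avoiding any given
   `z₀` variables, `D z₀ < e`.
3. **Mixing permutations** (`exists_mixing`): if `C(N,z)² (N-z)^{zd} < N^{zd}`, some `d`
   permutations `π₁,…,π_d` of an `N`-set have the property that any two `z`-sets `Z, Z'` satisfy
   `π_l(Z) ∩ Z' ≠ ∅` for some `l` (first moment: `#{σ : σ(Z) ∩ Z' = ∅} ≤ N! (1 - z/N)^z`,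
   `card_avoid_mul_pow_le`, by peeling one element of `Z` and comparing fibres with transpositions).
   The graph `v ↦ π_l v` has in- and out-degrees `≤ d`.
4. **Numerics and assembly** (`exists_data`): for `t` large, on `N ∈ [192t, 240t]` variables there
   are three-element scopes `S : Fin (768t) → Finset V`, right-hand sides over `𝔽₂` and `𝔽₃`, and a
   link graph of degree `≤ 115200`, such that every `≤ 192t/1728⁴` equations satisfy `|T| ≤ 2|∂T|`,
   both systems are robustly unsatisfiable at threshold `t`, and the link graph mixes all pairs of
   sets of more than `t` variables — exactly the hypotheses of `SparseOr.cohomologicallyKConsistent`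
   and `SparseOr.isEmpty_hom`.

## References

* [AtseriasDawar2019] A. Atserias, A. Dawar, *Definable inapproximability: new challenges for
  duplicator*, J. Log. Comput. 29 (2019), Lemma 5 (existence of the expander; the tree's
  `Xor3Gap.exists_threeUniformExpander`).
* [BenSassonWigderson2001] E. Ben-Sasson, A. Wigderson, *Short proofs are narrow*, J. ACM 48 (2001),
  §6 (random systems: expansion and unsatisfiability by first moments).
* [Vanlint1992] J. H. van Lint, *Introduction to Coding Theory*, Thm 1.4.5 (volume of Hamming balls;
  the tree's `vanLint_sum_choose_le_exp_binEntropy`).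
-/

namespace Literature.ModelTheory.FiniteModelTheory

open Finset

namespace SparseOrData

/-! ### 1. Degree splitting -/

section Split

variable {m n : ℕ} (F : Fin m → Finset (Fin n)) (D : ℕ)

/-- The number of scopes containing the variable `v`. [folklore] -/
def deg (v : Fin n) : ℕ := (Finset.univ.filter fun u => v ∈ F u).card

/-- The number of scopes containing `v` that come before `u`. [folklore] -/
def rank (u : Fin m) (v : Fin n) : ℕ :=
  ((Finset.univ.filter fun u' => v ∈ F u').filter fun u' => u' < u).card

/-- The number of copies of the variable `v` after splitting into blocks of `D` occurrences. [folklore] -/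
def copies (v : Fin n) : ℕ := deg F v / D + 1

/-- The variables of the split system: copies `(v, i)`, `i ≤ deg v / D`. [folklore] -/
abbrev SplitVar : Type := Σ v : Fin n, Fin (copies F D v)

/-- The rank of a scope at a variable is at most the degree of the variable. [folklore] -/
theorem rank_le_deg (u : Fin m) (v : Fin n) : rank F u v ≤ deg F v :=
  Finset.card_le_card (Finset.filter_subset _ _)

/-- Block numbers are smaller than the number of copies. [folklore] -/
theorem rank_div_lt (u : Fin m) (v : Fin n) : rank F u v / D < copies F D v :=
  Nat.lt_succ_of_le (Nat.div_le_div_right (rank_le_deg F u v))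

/-- The copy of `v` used by the scope `u`: block number `rank u v / D`. [folklore] -/
def idx (u : Fin m) (v : Fin n) : Fin (copies F D v) := ⟨rank F u v / D, rank_div_lt F D u v⟩

/-- The relabelling of the scope `u`. [folklore] -/
def splitEmb (u : Fin m) : Fin n ↪ SplitVar F D :=
  ⟨fun v => ⟨v, idx F D u v⟩, fun _ _ h => congrArg Sigma.fst h⟩

/-- THE SPLIT SCOPES: scope `u` with every variable replaced by its copy used by `u`. [folklore] -/
def splitScope (u : Fin m) : Finset (SplitVar F D) := (F u).map (splitEmb F D u)

/-- Splitting preserves the size of every scope. [folklore] -/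
@[simp] theorem card_splitScope (u : Fin m) : (splitScope F D u).card = (F u).card :=
  Finset.card_map _

/-- Membership in a split scope: a copy of a variable of the scope, with the block number used by that scope. [folklore] -/
theorem mem_splitScope {u : Fin m} {x : SplitVar F D} :
    x ∈ splitScope F D u ↔ x.1 ∈ F u ∧ x = ⟨x.1, idx F D u x.1⟩ := by
  unfold splitScope
  rw [Finset.mem_map]
  constructor
  · rintro ⟨v, hv, rfl⟩
    exact ⟨hv, rfl⟩
  · rintro ⟨hx, hxe⟩
    exact ⟨x.1, hx, hxe.symm⟩

/-- Ranks increase along the scopes containing a variable. [folklore] -/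
theorem rank_lt_rank {u u' : Fin m} {v : Fin n} (hu : v ∈ F u) (huu' : u < u') :
    rank F u v < rank F u' v := by
  unfold rank
  refine Finset.card_lt_card ⟨fun w hw => ?_, fun hsub => ?_⟩
  · rw [Finset.mem_filter] at hw ⊢
    exact ⟨hw.1, hw.2.trans huu'⟩
  · have hmem : u ∈ (Finset.univ.filter fun u'' => v ∈ F u'').filter fun u'' => u'' < u' :=
      Finset.mem_filter.2 ⟨Finset.mem_filter.2 ⟨Finset.mem_univ _, hu⟩, huu'⟩
    have := hsub hmem
    rw [Finset.mem_filter] at this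
    exact lt_irrefl _ this.2

/-- The rank is injective on the scopes containing a variable. [folklore] -/
theorem rank_injOn (v : Fin n) {u u' : Fin m} (hu : v ∈ F u) (hu' : v ∈ F u')
    (h : rank F u v = rank F u' v) : u = u' := by
  rcases lt_trichotomy u u' with hlt | heq | hgt
  · exact absurd h (rank_lt_rank F hu hlt).ne
  · exact heq
  · exact absurd h (rank_lt_rank F hu' hgt).ne'

/-- **Bounded degree after splitting**: every copy lies in at most `D` split scopes (`D ≥ 1`).
[folklore] -/
theorem splitDeg_le (hD : 0 < D) (x : SplitVar F D) :
    (Finset.univ.filter fun u => x ∈ splitScope F D u).card ≤ D := by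
  obtain ⟨v, i⟩ := x
  have hsub : ∀ u ∈ Finset.univ.filter (fun u => (⟨v, i⟩ : SplitVar F D) ∈ splitScope F D u),
      v ∈ F u ∧ rank F u v / D = i := by
    intro u hu
    rw [Finset.mem_filter, mem_splitScope] at hu
    obtain ⟨-, hv, he⟩ := hu
    refine ⟨hv, ?_⟩
    have := (Sigma.mk.inj_iff.1 he).2
    rw [heq_iff_eq] at this
    exact (congrArg Fin.val this).symm
  calc (Finset.univ.filter fun u => (⟨v, i⟩ : SplitVar F D) ∈ splitScope F D u).card
      ≤ (Finset.Ico (i * D) (i * D + D)).card := by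
        refine Finset.card_le_card_of_injOn (fun u => rank F u v) (fun u hu => ?_) ?_
        · obtain ⟨-, hi⟩ := hsub u hu
          rw [Finset.coe_Ico, Set.mem_Ico, ← hi]
          exact ⟨Nat.div_mul_le_self _ _, Nat.lt_div_mul_add hD⟩
        · intro u hu u' hu' h
          exact rank_injOn F v (hsub u hu).1 (hsub u' hu').1 h
    _ = D := by rw [Nat.card_Ico]; omega

/-- **Splitting does not lose neighbours**: `|N_F(T)| ≤ |N_split(T)|` (projection to the original
variable is onto). [folklore] -/
theorem card_biUnion_le_card_biUnion_split (T : Finset (Fin m)) :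
    (T.biUnion F).card ≤ (T.biUnion (splitScope F D)).card := by
  calc (T.biUnion F).card ≤ ((T.biUnion (splitScope F D)).image Sigma.fst).card := by
        refine Finset.card_le_card fun v hv => ?_
        obtain ⟨u, hu, hvu⟩ := Finset.mem_biUnion.1 hv
        exact Finset.mem_image.2 ⟨⟨v, idx F D u v⟩,
          Finset.mem_biUnion.2 ⟨u, hu, (mem_splitScope F D).2 ⟨hvu, rfl⟩⟩, rfl⟩
    _ ≤ (T.biUnion (splitScope F D)).card := Finset.card_image_le

/-- Double counting of incidences: `Σ_v deg v = Σ_u |F u|`. [folklore] -/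
theorem sum_deg_eq : ∑ v, deg F v = ∑ u, (F u).card := by
  unfold deg
  simp only [Finset.card_filter]
  rw [Finset.sum_comm]
  refine Finset.sum_congr rfl fun u _ => ?_
  rw [← Finset.card_filter, Finset.filter_mem_eq_inter, Finset.univ_inter]

/-- **Number of split variables**: between `n` and `n + (Σ_u |F u|)/D`. [folklore] -/
theorem card_splitVar_le (hD : 0 < D) :
    Fintype.card (SplitVar F D) ≤ n + (∑ u, (F u).card) / D := by
  rw [Fintype.card_sigma]
  simp only [Fintype.card_fin]
  unfold copies
  rw [Finset.sum_add_distrib, Finset.sum_const, Finset.card_univ, Fintype.card_fin, smul_eq_mul,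
    mul_one, add_comm, ← sum_deg_eq]
  refine Nat.add_le_add_left ((Nat.le_div_iff_mul_le hD).2 ?_) n
  rw [Finset.sum_mul]
  exact Finset.sum_le_sum fun v _ => Nat.div_mul_le_self _ _

/-- Splitting does not decrease the number of variables (every variable has at least one copy). [folklore] -/
theorem le_card_splitVar : n ≤ Fintype.card (SplitVar F D) := by
  rw [Fintype.card_sigma]
  simp only [Fintype.card_fin]
  unfold copies
  calc n = ∑ _v : Fin n, 1 := by simp
    _ ≤ ∑ v, (deg F v / D + 1) := Finset.sum_le_sum fun v _ => Nat.le_add_left _ _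

end Split

/-! ### 2. Far right-hand sides and robust unsatisfiability -/

section Far

variable {V : Type*} [Fintype V] [DecidableEq V] {m : ℕ} {p : ℕ} [NeZero p]

/-- **Volume of a Hamming ball** (crude form): the vectors `b : Fin m → ZMod p` differing from `y` in
fewer than `e` coordinates number at most `p^e · Σ_{i<e} C(m,i)`. [cite: Vanlint1992, Thm 1.4.5 (context: volume of Hamming balls)] -/
theorem card_ball_le (y : Fin m → ZMod p) (e : ℕ) :
    (Finset.univ.filter fun b : Fin m → ZMod p =>
        (Finset.univ.filter fun u => b u ≠ y u).card < e).card ≤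
      p ^ e * ∑ i ∈ Finset.range e, m.choose i := by
  classical
  have hp : 1 ≤ p := Nat.one_le_iff_ne_zero.2 (NeZero.ne p)
  -- cover by the sets `{b : b = y off T}`, `|T| < e`
  set box : Finset (Fin m) → Finset (Fin m → ZMod p) := fun T =>
    Finset.univ.filter fun b => ∀ u, u ∉ T → b u = y u with hbox
  have hcover : (Finset.univ.filter fun b : Fin m → ZMod p =>
      (Finset.univ.filter fun u => b u ≠ y u).card < e) ⊆
      (Finset.univ.filter fun T : Finset (Fin m) => T.card < e).biUnion box := by
    intro b hb
    rw [Finset.mem_filter] at hb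
    refine Finset.mem_biUnion.2 ⟨Finset.univ.filter fun u => b u ≠ y u,
      Finset.mem_filter.2 ⟨Finset.mem_univ _, hb.2⟩, ?_⟩
    rw [hbox, Finset.mem_filter]
    refine ⟨Finset.mem_univ _, fun u hu => ?_⟩
    by_contra hne
    exact hu (Finset.mem_filter.2 ⟨Finset.mem_univ _, hne⟩)
  -- each box has at most `p^|T| ≤ p^e` elements
  have hboxcard : ∀ T : Finset (Fin m), T.card < e → (box T).card ≤ p ^ e := by
    intro T hT
    calc (box T).card ≤ Fintype.card (↥T → ZMod p) := by
          rw [← Finset.card_univ]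
          refine Finset.card_le_card_of_injOn (fun b (t : ↥T) => b t) (fun _ _ => Finset.mem_coe.2
            (Finset.mem_univ _)) ?_
          intro b₁ hb₁ b₂ hb₂ h
          rw [Finset.mem_coe, hbox, Finset.mem_filter] at hb₁ hb₂
          funext u
          by_cases hu : u ∈ T
          · exact congr_fun h ⟨u, hu⟩
          · rw [hb₁.2 u hu, hb₂.2 u hu]
      _ = p ^ T.card := by rw [Fintype.card_fun, ZMod.card, Fintype.card_coe]
      _ ≤ p ^ e := Nat.pow_le_pow_right hp hT.le
  -- the number of `T` with `|T| < e`
  have hTcount : (Finset.univ.filter fun T : Finset (Fin m) => T.card < e).card ≤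
      ∑ i ∈ Finset.range e, m.choose i := by
    have hsub : (Finset.univ.filter fun T : Finset (Fin m) => T.card < e) ⊆
        (Finset.range e).biUnion fun i => Finset.powersetCard i Finset.univ := by
      intro T hT
      rw [Finset.mem_filter] at hT
      exact Finset.mem_biUnion.2 ⟨T.card, Finset.mem_range.2 hT.2,
        Finset.mem_powersetCard.2 ⟨Finset.subset_univ _, rfl⟩⟩
    refine (Finset.card_le_card hsub).trans (Finset.card_biUnion_le.trans ?_)
    refine Finset.sum_le_sum fun i _ => ?_
    rw [Finset.card_powersetCard, Finset.card_univ, Fintype.card_fin]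
  calc _ ≤ ((Finset.univ.filter fun T : Finset (Fin m) => T.card < e).biUnion box).card :=
        Finset.card_le_card hcover
    _ ≤ ∑ T ∈ Finset.univ.filter (fun T : Finset (Fin m) => T.card < e), (box T).card :=
        Finset.card_biUnion_le
    _ ≤ ∑ _T ∈ Finset.univ.filter (fun T : Finset (Fin m) => T.card < e), p ^ e :=
        Finset.sum_le_sum fun T hT => hboxcard T (Finset.mem_filter.1 hT).2
    _ = (Finset.univ.filter fun T : Finset (Fin m) => T.card < e).card * p ^ e := by
        rw [Finset.sum_const, smul_eq_mul]
    _ ≤ (∑ i ∈ Finset.range e, m.choose i) * p ^ e := Nat.mul_le_mul_right _ hTcount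
    _ = p ^ e * ∑ i ∈ Finset.range e, m.choose i := mul_comm _ _

/-- **Far right-hand sides exist**: if `p^{|V|} · p^e · Σ_{i<e} C(m,i) < p^m` then for some `b` every
assignment `x : V → ZMod p` violates at least `e` of the equations `∑_{v ∈ S u} x v = b u` (the
balls of radius `< e` around the vectors `(∑_{v ∈ S u} x v)_u` do not cover `(ZMod p)^m`).
[cite: BenSassonWigderson2001, §6 (unsatisfiability of random systems by a first moment)] -/
theorem exists_far (S : Fin m → Finset V) (e : ℕ)
    (hnum : p ^ Fintype.card V * (p ^ e * ∑ i ∈ Finset.range e, m.choose i) < p ^ m) :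
    ∃ b : Fin m → ZMod p, ∀ x : V → ZMod p,
      e ≤ (Finset.univ.filter fun u => ∑ v ∈ S u, x v ≠ b u).card := by
  classical
  set bad : Finset (Fin m → ZMod p) := Finset.univ.filter fun b =>
    ∃ x : V → ZMod p, (Finset.univ.filter fun u => ∑ v ∈ S u, x v ≠ b u).card < e with hbad
  have hcard : bad.card < Fintype.card (Fin m → ZMod p) := by
    have hcover : bad ⊆ (Finset.univ : Finset (V → ZMod p)).biUnion fun x =>
        Finset.univ.filter fun b : Fin m → ZMod p =>
          (Finset.univ.filter fun u => b u ≠ ∑ v ∈ S u, x v).card < e := by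
      intro b hb
      rw [hbad, Finset.mem_filter] at hb
      obtain ⟨x, hx⟩ := hb.2
      refine Finset.mem_biUnion.2 ⟨x, Finset.mem_univ _, Finset.mem_filter.2 ⟨Finset.mem_univ _, ?_⟩⟩
      convert hx using 2
      ext u
      simp only [Finset.mem_filter, Finset.mem_univ, true_and]
      exact ne_comm
    calc bad.card ≤ _ := Finset.card_le_card hcover
      _ ≤ ∑ x : V → ZMod p, (Finset.univ.filter fun b : Fin m → ZMod p =>
          (Finset.univ.filter fun u => b u ≠ ∑ v ∈ S u, x v).card < e).card := Finset.card_biUnion_le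
      _ ≤ ∑ _x : V → ZMod p, p ^ e * ∑ i ∈ Finset.range e, m.choose i :=
          Finset.sum_le_sum fun x _ => card_ball_le _ e
      _ = p ^ Fintype.card V * (p ^ e * ∑ i ∈ Finset.range e, m.choose i) := by
          rw [Finset.sum_const, smul_eq_mul, Finset.card_univ, Fintype.card_fun, ZMod.card]
      _ < p ^ m := hnum
      _ = Fintype.card (Fin m → ZMod p) := by rw [Fintype.card_fun, ZMod.card, Fintype.card_fin]
  rw [← Finset.card_univ] at hcard
  obtain ⟨b, -, hb⟩ := Finset.exists_mem_notMem_of_card_lt_card hcard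
  refine ⟨b, fun x => ?_⟩
  by_contra hlt
  exact hb (Finset.mem_filter.2 ⟨Finset.mem_univ _, x, not_le.1 hlt⟩)

omit [Fintype V] [NeZero p] in
/-- **Robust unsatisfiability from far right-hand sides and bounded degree**: if every assignment
violates at least `e` equations and every variable lies in at most `D` scopes, then for every set
`Z` of at most `z₀` variables (`D z₀ < e`) every assignment violates an equation whose scope avoids
`Z`. [folklore] -/
theorem robust_of_far (S : Fin m → Finset V) {D e z₀ : ℕ}
    (hdeg : ∀ v : V, (Finset.univ.filter fun u => v ∈ S u).card ≤ D) (hz : D * z₀ < e)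
    {b : Fin m → ZMod p}
    (hfar : ∀ x : V → ZMod p, e ≤ (Finset.univ.filter fun u => ∑ v ∈ S u, x v ≠ b u).card)
    (Z : Finset V) (hZ : Z.card ≤ z₀) (x : V → ZMod p) :
    ∃ u, Disjoint (S u) Z ∧ ∑ v ∈ S u, x v ≠ b u := by
  by_contra hno
  have hsub : (Finset.univ.filter fun u => ∑ v ∈ S u, x v ≠ b u) ⊆
      Z.biUnion fun v => Finset.univ.filter fun u => v ∈ S u := by
    intro u hu
    rw [Finset.mem_filter] at hu
    have hndisj : ¬ Disjoint (S u) Z := fun hd => hno ⟨u, hd, hu.2⟩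
    obtain ⟨v, hvS, hvZ⟩ := Finset.not_disjoint_iff.1 hndisj
    exact Finset.mem_biUnion.2 ⟨v, hvZ, Finset.mem_filter.2 ⟨Finset.mem_univ _, hvS⟩⟩
  have := calc e ≤ _ := hfar x
    _ ≤ (Z.biUnion fun v => Finset.univ.filter fun u => v ∈ S u).card := Finset.card_le_card hsub
    _ ≤ ∑ v ∈ Z, (Finset.univ.filter fun u => v ∈ S u).card := Finset.card_biUnion_le
    _ ≤ ∑ _v ∈ Z, D := Finset.sum_le_sum fun v _ => hdeg v
    _ = D * Z.card := by rw [Finset.sum_const, smul_eq_mul, mul_comm]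
    _ ≤ D * z₀ := Nat.mul_le_mul_left D hZ
  omega

end Far

/-! ### 3. Mixing permutations -/

section Mixing

variable {V : Type*} [Fintype V] [DecidableEq V]

/-- The permutations mapping `Z` into the complement of `Z'`. [folklore] -/
def avoid (Z Z' : Finset V) : Finset (Equiv.Perm V) :=
  Finset.univ.filter fun σ => ∀ v ∈ Z, σ v ∉ Z'

/-- Membership in `avoid Z Z'` unfolded. [folklore] -/
theorem mem_avoid {Z Z' : Finset V} {σ : Equiv.Perm V} : σ ∈ avoid Z Z' ↔ ∀ v ∈ Z, σ v ∉ Z' := by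
  unfold avoid; rw [Finset.mem_filter]; simp only [Finset.mem_univ, true_and]

/-- **Peeling one element.** `#avoid(Z ∪ {v₀}, Z') · N ≤ (N - |Z'|) · #avoid(Z, Z')`: conditioned on
the values on `Z`, the value at `v₀` avoids `Z'` with probability `(N-|Z|-|Z'|)/(N-|Z|) ≤ (N-|Z'|)/N`
— formally, the fibres of `σ ↦ σ v₀` on `avoid (Z ∪ {v₀}) Z'` over points outside `Z'` all have the
size of the fibre over a fixed `w₁ ∉ Z'`, and that fibre embeds into every fibre of `σ ↦ σ v₀` on
`avoid Z Z'` (compose with the transposition `(w w₁)`). [folklore] -/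
theorem card_avoid_insert_mul_le (Z Z' : Finset V) {v₀ : V} (hv₀ : v₀ ∉ Z)
    (hZ' : Z'.card < Fintype.card V) :
    (avoid (insert v₀ Z) Z').card * Fintype.card V ≤ (Fintype.card V - Z'.card) * (avoid Z Z').card := by
  classical
  set A := avoid Z Z' with hA
  set A' := avoid (insert v₀ Z) Z' with hA'
  -- a point outside `Z'`
  obtain ⟨w₁, -, hw₁⟩ : ∃ w₁ ∈ (Finset.univ : Finset V), w₁ ∉ Z' :=
    Finset.exists_mem_notMem_of_card_lt_card (by rwa [Finset.card_univ])
  set fib : V → Finset (Equiv.Perm V) := fun w => A.filter fun σ => σ v₀ = w with hfib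
  -- `A'` is the union of the fibres over the complement of `Z'`
  have hA'eq : A'.card = ∑ w ∈ Finset.univ \ Z', (fib w).card := by
    have hmaps : ∀ σ ∈ A', σ v₀ ∈ Finset.univ \ Z' := fun σ hσ =>
      Finset.mem_sdiff.2 ⟨Finset.mem_univ _, (mem_avoid.1 hσ) v₀ (Finset.mem_insert_self _ _)⟩
    rw [Finset.card_eq_sum_card_fiberwise hmaps]
    refine Finset.sum_congr rfl fun w hw => ?_
    congr 1
    ext σ
    rw [Finset.mem_filter, Finset.mem_filter, mem_avoid, mem_avoid]
    constructor
    · rintro ⟨h, rfl⟩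
      exact ⟨fun v hv => h v (Finset.mem_insert_of_mem hv), rfl⟩
    · rintro ⟨h, rfl⟩
      refine ⟨fun v hv => ?_, rfl⟩
      rcases Finset.mem_insert.1 hv with rfl | hv
      · exact (Finset.mem_sdiff.1 hw).2
      · exact h v hv
  -- `A` is the union of all fibres
  have hAeq : A.card = ∑ w, (fib w).card :=
    Finset.card_eq_sum_card_fiberwise fun σ _ => Finset.mem_univ (σ v₀)
  -- the fibre over a point outside `Z'` is the smallest: compose with the transposition `(w w')`
  have hcomp : ∀ (w : V) {w' : V}, w' ∉ Z' → (fib w').card ≤ (fib w).card := by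
    intro w w' hw'
    refine Finset.card_le_card_of_injOn (fun σ => Equiv.swap w w' * σ) (fun σ hσ => ?_) ?_
    · rw [Finset.mem_coe, hfib, Finset.mem_filter, mem_avoid] at hσ ⊢
      obtain ⟨havoid, hσv₀⟩ := hσ
      refine ⟨fun v hv => ?_, by rw [Equiv.Perm.mul_apply, hσv₀, Equiv.swap_apply_right]⟩
      rw [Equiv.Perm.mul_apply]
      have hne' : σ v ≠ w' := by
        rw [← hσv₀]
        exact fun h => hv₀ (σ.injective h ▸ hv)
      by_cases hvw : σ v = w
      · rw [hvw, Equiv.swap_apply_left]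
        exact hw'
      · rw [Equiv.swap_apply_of_ne_of_ne hvw hne']
        exact havoid v hv
    · intro σ _ τ _ h
      exact mul_left_cancel h
  -- all fibres over the complement of `Z'` have the size of the one over `w₁`
  have hout : ∀ w ∈ Finset.univ \ Z', (fib w).card = (fib w₁).card := fun w hw =>
    le_antisymm (hcomp w₁ (Finset.mem_sdiff.1 hw).2) (hcomp w hw₁)
  have h1 : A'.card = (Fintype.card V - Z'.card) * (fib w₁).card := by
    rw [hA'eq, Finset.sum_const_nat hout, Finset.card_sdiff_of_subset (Finset.subset_univ _),
      Finset.card_univ]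
  have h2 : Fintype.card V * (fib w₁).card ≤ A.card := by
    rw [hAeq, ← Finset.card_univ, ← smul_eq_mul, ← Finset.sum_const]
    exact Finset.sum_le_sum fun w _ => hcomp w hw₁
  calc A'.card * Fintype.card V = (Fintype.card V - Z'.card) * (Fintype.card V * (fib w₁).card) := by
        rw [h1]; ring
    _ ≤ (Fintype.card V - Z'.card) * A.card := Nat.mul_le_mul_left _ h2

/-- **First moment for one permutation**: `#{σ : σ(Z) ∩ Z' = ∅} · N^{|Z|} ≤ (N - |Z'|)^{|Z|} · N!`,
i.e. a uniformly random perfect matching avoids the rectangle `Z × Z'` with probability at most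
`(1 - |Z'|/N)^{|Z|}`. [folklore] -/
theorem card_avoid_mul_pow_le (Z Z' : Finset V) (hZ' : Z'.card < Fintype.card V) :
    (avoid Z Z').card * Fintype.card V ^ Z.card ≤
      (Fintype.card V - Z'.card) ^ Z.card * (Fintype.card V).factorial := by
  classical
  induction Z using Finset.induction_on with
  | empty =>
    have : avoid (∅ : Finset V) Z' = Finset.univ := by
      ext σ; simp [mem_avoid]
    rw [this, Finset.card_univ, Fintype.card_perm, Finset.card_empty, pow_zero, pow_zero, mul_one,
      one_mul]
  | insert v₀ Z hv₀ ih =>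
    rw [Finset.card_insert_of_notMem hv₀, pow_succ, pow_succ]
    calc (avoid (insert v₀ Z) Z').card * (Fintype.card V ^ Z.card * Fintype.card V)
        = (avoid (insert v₀ Z) Z').card * Fintype.card V * Fintype.card V ^ Z.card := by ring
      _ ≤ (Fintype.card V - Z'.card) * (avoid Z Z').card * Fintype.card V ^ Z.card :=
          Nat.mul_le_mul_right _ (card_avoid_insert_mul_le Z Z' hv₀ hZ')
      _ = (Fintype.card V - Z'.card) * ((avoid Z Z').card * Fintype.card V ^ Z.card) := by ring
      _ ≤ (Fintype.card V - Z'.card) * ((Fintype.card V - Z'.card) ^ Z.card *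
            (Fintype.card V).factorial) := Nat.mul_le_mul_left _ ih
      _ = (Fintype.card V - Z'.card) ^ Z.card * (Fintype.card V - Z'.card) *
            (Fintype.card V).factorial := by ring

/-- **Mixing families of permutations exist**: if `C(N,z)² (N - z)^{zd} < N^{zd}` (and `z < N`) then
some `d` permutations `π_l` of the `N`-set `V` connect every two sets of at least `z` elements:
`π_l v = w` for some `l`, `v ∈ Z`, `w ∈ Z'` (union bound over the pairs of `z`-subsets).
[folklore] -/
theorem exists_mixing (z d : ℕ) (hz : z < Fintype.card V)
    (hnum : (Fintype.card V).choose z ^ 2 * (Fintype.card V - z) ^ (z * d) <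
      Fintype.card V ^ (z * d)) :
    ∃ π : Fin d → Equiv.Perm V, ∀ Z Z' : Finset V, z ≤ Z.card → z ≤ Z'.card →
      ∃ v ∈ Z, ∃ w ∈ Z', ∃ l, π l v = w := by
  classical
  set N := Fintype.card V with hN
  -- the bad families: some pair of `z`-sets is avoided by every permutation
  set pairs : Finset (Finset V × Finset V) :=
    (Finset.powersetCard z Finset.univ) ×ˢ (Finset.powersetCard z Finset.univ) with hpairs
  set bad : Finset (Fin d → Equiv.Perm V) := Finset.univ.filter fun π =>
    ∃ P ∈ pairs, ∀ l, π l ∈ avoid P.1 P.2 with hbad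
  have hcover : bad ⊆ pairs.biUnion fun P => Fintype.piFinset fun _ : Fin d => avoid P.1 P.2 := by
    intro π hπ
    rw [hbad, Finset.mem_filter] at hπ
    obtain ⟨P, hP, hall⟩ := hπ.2
    exact Finset.mem_biUnion.2 ⟨P, hP, Fintype.mem_piFinset.2 hall⟩
  have havoid : ∀ P ∈ pairs, (avoid P.1 P.2).card ^ d * N ^ (z * d) ≤
      (N - z) ^ (z * d) * N.factorial ^ d := by
    intro P hP
    rw [hpairs, Finset.mem_product, Finset.mem_powersetCard, Finset.mem_powersetCard] at hP
    obtain ⟨⟨-, h1⟩, -, h2⟩ := hP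
    have h := card_avoid_mul_pow_le P.1 P.2 (by rw [h2]; exact hz)
    rw [h1, h2] at h
    calc (avoid P.1 P.2).card ^ d * N ^ (z * d) = ((avoid P.1 P.2).card * N ^ z) ^ d := by
          rw [mul_pow, ← pow_mul]
      _ ≤ ((N - z) ^ z * N.factorial) ^ d := Nat.pow_le_pow_left h d
      _ = (N - z) ^ (z * d) * N.factorial ^ d := by rw [mul_pow, ← pow_mul]
  have hpairs_card : pairs.card = N.choose z ^ 2 := by
    rw [hpairs, Finset.card_product, Finset.card_powersetCard, Finset.card_univ, sq]
  have hbadcard : bad.card * N ^ (z * d) < N.factorial ^ d * N ^ (z * d) := by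
    calc bad.card * N ^ (z * d)
        ≤ (∑ P ∈ pairs, (Fintype.piFinset fun _ : Fin d => avoid P.1 P.2).card) * N ^ (z * d) :=
          Nat.mul_le_mul_right _ ((Finset.card_le_card hcover).trans Finset.card_biUnion_le)
      _ = ∑ P ∈ pairs, (avoid P.1 P.2).card ^ d * N ^ (z * d) := by
          rw [Finset.sum_mul]
          refine Finset.sum_congr rfl fun P _ => ?_
          rw [Fintype.card_piFinset, Finset.prod_const, Finset.card_univ, Fintype.card_fin]
      _ ≤ ∑ _P ∈ pairs, (N - z) ^ (z * d) * N.factorial ^ d := Finset.sum_le_sum havoid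
      _ = N.choose z ^ 2 * (N - z) ^ (z * d) * N.factorial ^ d := by
          rw [Finset.sum_const, smul_eq_mul, hpairs_card, mul_assoc]
      _ < N ^ (z * d) * N.factorial ^ d :=
          Nat.mul_lt_mul_of_pos_right hnum (pow_pos (Nat.factorial_pos N) d)
      _ = N.factorial ^ d * N ^ (z * d) := mul_comm _ _
  have hlt : bad.card < (Finset.univ : Finset (Fin d → Equiv.Perm V)).card := by
    rw [Finset.card_univ, Fintype.card_fun, Fintype.card_perm, Fintype.card_fin]
    exact Nat.lt_of_mul_lt_mul_right hbadcard
  obtain ⟨π, -, hπ⟩ := Finset.exists_mem_notMem_of_card_lt_card hlt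
  refine ⟨π, fun Z Z' hZ hZ' => ?_⟩
  obtain ⟨Z₀, hZ₀, hZ₀c⟩ := Finset.exists_subset_card_eq hZ
  obtain ⟨Z₀', hZ₀', hZ₀'c⟩ := Finset.exists_subset_card_eq hZ'
  by_contra hno
  refine hπ (Finset.mem_filter.2 ⟨Finset.mem_univ _, (Z₀, Z₀'), ?_, fun l => ?_⟩)
  · rw [hpairs, Finset.mem_product, Finset.mem_powersetCard, Finset.mem_powersetCard]
    exact ⟨⟨Finset.subset_univ _, hZ₀c⟩, Finset.subset_univ _, hZ₀'c⟩
  · refine mem_avoid.2 fun v hv hw => hno ⟨v, hZ₀ hv, π l v, hZ₀' hw, l, rfl⟩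

end Mixing

/-! ### 4. Numerics -/

section Numerics

open Real

/-- **The mixing inequality**: `C(N,z)² (N-z)^{zd} < N^{zd}` as soon as `1 ≤ z ≤ N ≤ 240 z` and
`d = 115200 = 2 · 240²` (from `C(N,z) ≤ 2^N`, `1 - z/N ≤ e^{-z/N}` and `N log 4 < z² d / N`).
[folklore] -/
theorem mixing_ineq {N z : ℕ} (hz : 1 ≤ z) (hzN : z ≤ N) (hN : N ≤ 240 * z) :
    N.choose z ^ 2 * (N - z) ^ (z * 115200) < N ^ (z * 115200) := by
  set d : ℕ := 115200 with hd
  have hNpos : (0 : ℝ) < N := by exact_mod_cast (lt_of_lt_of_le hz hzN)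
  have hzpos : (0 : ℝ) < z := by exact_mod_cast hz
  -- real form
  suffices h : ((N.choose z : ℝ)) ^ 2 * ((N : ℝ) - z) ^ (z * d) < (N : ℝ) ^ (z * d) by
    have h' : ((N.choose z ^ 2 * (N - z) ^ (z * d) : ℕ) : ℝ) < ((N ^ (z * d) : ℕ) : ℝ) := by
      push_cast [Nat.cast_sub hzN]
      exact h
    exact_mod_cast h'
  -- `(N - z)^{zd} = N^{zd} (1 - z/N)^{zd}`
  have hq : ((N : ℝ) - z) = N * (1 - z / N) := by field_simp
  have hq0 : (0 : ℝ) ≤ 1 - z / N := by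
    rw [sub_nonneg, div_le_one hNpos]; exact_mod_cast hzN
  rw [hq, mul_pow, ← mul_assoc, mul_comm (((N.choose z : ℝ)) ^ 2), mul_assoc]
  refine mul_lt_of_lt_one_right (pow_pos hNpos _) ?_
  -- `C(N,z)^2 ≤ 4^N = exp (N log 4)` and `(1 - z/N)^{zd} ≤ exp (-(z/N) (zd))`
  have h1 : ((N.choose z : ℝ)) ^ 2 ≤ Real.exp (N * Real.log 4) := by
    have hc : (N.choose z : ℝ) ≤ 2 ^ N := by exact_mod_cast Nat.choose_le_two_pow N z
    calc ((N.choose z : ℝ)) ^ 2 ≤ ((2 : ℝ) ^ N) ^ 2 := by gcongr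
      _ = (4 : ℝ) ^ N := by rw [← pow_mul, mul_comm, pow_mul]; norm_num
      _ = Real.exp (N * Real.log 4) := by
          rw [Real.exp_nat_mul, Real.exp_log (by norm_num : (0 : ℝ) < 4)]
  have h2 : (1 - (z : ℝ) / N) ^ (z * d) ≤ Real.exp (-((z : ℝ) / N) * (z * d : ℕ)) := by
    have hle : 1 - (z : ℝ) / N ≤ Real.exp (-((z : ℝ) / N)) := by
      have := Real.add_one_le_exp (-((z : ℝ) / N)); linarith
    calc (1 - (z : ℝ) / N) ^ (z * d) ≤ (Real.exp (-((z : ℝ) / N))) ^ (z * d) :=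
          pow_le_pow_left₀ hq0 hle _
      _ = Real.exp (-((z : ℝ) / N) * (z * d : ℕ)) := by
          rw [← Real.exp_nat_mul, mul_comm]
  calc ((N.choose z : ℝ)) ^ 2 * (1 - (z : ℝ) / N) ^ (z * d)
      ≤ Real.exp (N * Real.log 4) * Real.exp (-((z : ℝ) / N) * (z * d : ℕ)) :=
        mul_le_mul h1 h2 (pow_nonneg hq0 _) (Real.exp_pos _).le
    _ = Real.exp (N * Real.log 4 - (z : ℝ) * z * d / N) := by
        rw [← Real.exp_add]; congr 1; push_cast; ring
    _ < 1 := by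
        rw [Real.exp_lt_one_iff, sub_neg]
        -- `N log 4 < z² d / N` since `N² log 4 < 2 N² ≤ 2 · 240² z² = d z²`
        rw [lt_div_iff₀ hNpos]
        have hN' : (N : ℝ) ≤ 240 * z := by exact_mod_cast hN
        have hlog : Real.log 4 < 2 := by
          have h : Real.log 4 = 2 * Real.log 2 := by
            rw [show (4 : ℝ) = 2 ^ 2 by norm_num, Real.log_pow]; norm_num
          rw [h]
          have := Real.log_two_lt_d9
          linarith
        have hd' : (d : ℝ) = 115200 := by rw [hd]; norm_num
        rw [hd']
        nlinarith [mul_pos hNpos hNpos, hzpos]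

/-- `binEntropy (1/16) ≤ log 2 / 4 + 1/16` (from `log 16 = 4 log 2` and `log (16/15) ≤ 1/15`).
[folklore] -/
theorem binEntropy_sixteenth_le : Real.binEntropy (1 / 16) ≤ Real.log 2 / 4 + 1 / 16 := by
  rw [Real.binEntropy]
  have h1 : (1 / 16 : ℝ) * Real.log (1 / 16)⁻¹ = Real.log 2 / 4 := by
    rw [one_div, inv_inv, show (16 : ℝ) = 2 ^ 4 by norm_num, Real.log_pow]; ring
  have h2 : (1 - 1 / 16 : ℝ) * Real.log (1 - 1 / 16)⁻¹ ≤ 1 / 16 := by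
    have hx : (0 : ℝ) < (1 - 1 / 16)⁻¹ := by norm_num
    have := Real.log_le_sub_one_of_pos hx
    have h15 : (0 : ℝ) ≤ 1 - 1 / 16 := by norm_num
    calc (1 - 1 / 16 : ℝ) * Real.log (1 - 1 / 16)⁻¹ ≤ (1 - 1 / 16) * ((1 - 1 / 16)⁻¹ - 1) :=
          mul_le_mul_of_nonneg_left this h15
      _ = 1 / 16 := by norm_num
  linarith

/-- **The far-point inequality** for the parameters of `exists_data`: with `m = 768t` equations,
at most `240t` variables and `e = 48t + 1`, `p^{|V|} · p^e · Σ_{i<e} C(m,i) < p^m` for every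
`p ≥ 2` (van Lint's entropy bound with `λ = 1/16`, `binEntropy (1/16) < 0.24`). [folklore] -/
theorem far_ineq {p nV t : ℕ} (hp : 2 ≤ p) (ht : 1 ≤ t) (hV : nV ≤ 240 * t) :
    p ^ nV * (p ^ (48 * t + 1) * ∑ i ∈ Finset.range (48 * t + 1), (768 * t).choose i) <
      p ^ (768 * t) := by
  have hp0 : (0 : ℝ) < p := by exact_mod_cast (lt_of_lt_of_le two_pos hp)
  have hp1 : (1 : ℝ) ≤ p := by exact_mod_cast (le_trans one_le_two hp)
  -- van Lint with `λ = 1/16`, `n = 768 t`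
  have hvl := Literature.Combinatorics.vanLint_sum_choose_le_exp_binEntropy (768 * t)
    (by norm_num : (0 : ℝ) ≤ 1 / 16) (by norm_num : (1 / 16 : ℝ) ≤ 1 / 2)
  have hfloor : ⌊(1 / 16 : ℝ) * (768 * t : ℕ)⌋₊ = 48 * t := by
    have : (1 / 16 : ℝ) * (768 * t : ℕ) = ((48 * t : ℕ) : ℝ) := by push_cast; ring
    rw [this, Nat.floor_natCast]
  rw [hfloor] at hvl
  -- real form of the goal
  suffices h : (p : ℝ) ^ nV * ((p : ℝ) ^ (48 * t + 1) *
      ∑ i ∈ Finset.range (48 * t + 1), ((768 * t).choose i : ℝ)) < (p : ℝ) ^ (768 * t) by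
    exact_mod_cast h
  have hsum0 : (0 : ℝ) ≤ ∑ i ∈ Finset.range (48 * t + 1), ((768 * t).choose i : ℝ) :=
    Finset.sum_nonneg fun i _ => Nat.cast_nonneg _
  -- bound the powers of `p` by `p^{288 t + 1}` and the sum by `exp (768 t H)`
  have hpow : (p : ℝ) ^ nV * (p : ℝ) ^ (48 * t + 1) ≤ (p : ℝ) ^ (288 * t + 1) := by
    rw [← pow_add]
    exact pow_le_pow_right₀ hp1 (by omega)
  have hH := binEntropy_sixteenth_le
  have hlog := Real.log_two_gt_d9
  calc (p : ℝ) ^ nV * ((p : ℝ) ^ (48 * t + 1) * ∑ i ∈ Finset.range (48 * t + 1), ((768 * t).choose i : ℝ))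
      = ((p : ℝ) ^ nV * (p : ℝ) ^ (48 * t + 1)) *
          ∑ i ∈ Finset.range (48 * t + 1), ((768 * t).choose i : ℝ) := by ring
    _ ≤ (p : ℝ) ^ (288 * t + 1) * Real.exp ((768 * t : ℕ) * Real.binEntropy (1 / 16)) :=
        mul_le_mul hpow hvl hsum0 (pow_nonneg hp0.le _)
    _ < (p : ℝ) ^ (288 * t + 1) * (p : ℝ) ^ (480 * t - 1) := by
        refine mul_lt_mul_of_pos_left ?_ (pow_pos hp0 _)
        -- `exp (768 t H) < 2^{480t-1} ≤ p^{480t-1}`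
        have h2 : Real.exp ((768 * t : ℕ) * Real.binEntropy (1 / 16)) < (2 : ℝ) ^ (480 * t - 1) := by
          rw [show (2 : ℝ) ^ (480 * t - 1) = Real.exp ((480 * t - 1 : ℕ) * Real.log 2) by
            rw [Real.exp_nat_mul, Real.exp_log two_pos], Real.exp_lt_exp]
          have ht' : (1 : ℝ) ≤ t := by exact_mod_cast ht
          have hcast : ((480 * t - 1 : ℕ) : ℝ) = 480 * t - 1 := by
            rw [Nat.cast_sub (by omega), Nat.cast_mul]; norm_num
          rw [hcast]
          push_cast
          nlinarith
        calc Real.exp ((768 * t : ℕ) * Real.binEntropy (1 / 16)) < (2 : ℝ) ^ (480 * t - 1) := h2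
          _ ≤ (p : ℝ) ^ (480 * t - 1) := pow_le_pow_left₀ (by norm_num) (by exact_mod_cast hp) _
    _ = (p : ℝ) ^ (768 * t) := by rw [← pow_add]; congr 1; omega

end Numerics

/-! ### 5. Assembly -/

section Assembly

/-- **The data for the sparse OR-instances.**  For every `t ≥ 1728⁴` there are: a finite variable
set `V` with `192t ≤ |V| ≤ 240t`, three-element scopes `S : Fin (768t) → Finset V` in which every
set of at most `192t/1728⁴` equations `T` has `|T| ≤ 2|∂T|` and every variable occurs at most `48`
times, right-hand sides `b₂, b₃` over `𝔽₂, 𝔽₃` making every assignment violate an equation avoiding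
any given `t` variables, and a link graph `G` with in- and out-degrees `≤ 115200` joining any two sets
of more than `t` variables.  (Expander by Atserias–Dawar's counting, split into blocks of `48`
occurrences; far right-hand sides and mixing permutations by first moments.) [folklore] -/
theorem exists_data (t : ℕ) (ht : 1728 ^ 4 ≤ t) :
    ∃ (V : Type) (_ : Fintype V) (_ : DecidableEq V) (S : Fin (768 * t) → Finset V)
      (b₂ : Fin (768 * t) → ZMod 2) (b₃ : Fin (768 * t) → ZMod 3) (G : V → V → Prop)
      (_ : DecidableRel G),
      192 * t ≤ Fintype.card V ∧ Fintype.card V ≤ 240 * t ∧ (∀ u, (S u).card = 3) ∧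
      (∀ T : Finset (Fin (768 * t)), T.card ≤ 192 * t / 1728 ^ 4 →
        T.card ≤ 2 * (XorSystem.boundary S T).card) ∧
      (∀ v : V, (Finset.univ.filter fun w => G v w).card ≤ 115200) ∧
      (∀ w : V, (Finset.univ.filter fun v => G v w).card ≤ 115200) ∧
      (∀ Z : Finset V, Z.card ≤ t → ∀ x : V → ZMod 2, ∃ u, Disjoint (S u) Z ∧ ∑ v ∈ S u, x v ≠ b₂ u) ∧
      (∀ Z : Finset V, Z.card ≤ t → ∀ x : V → ZMod 3, ∃ u, Disjoint (S u) Z ∧ ∑ v ∈ S u, x v ≠ b₃ u) ∧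
      (∀ Z Z' : Finset V, t < Z.card → t < Z'.card → ∃ v ∈ Z, ∃ w ∈ Z', G v w) := by
  classical
  have ht1 : 1 ≤ t := le_trans (Nat.one_le_pow _ _ (by norm_num)) ht
  -- the expander
  obtain ⟨F, hF3, hFexp⟩ := Xor3Gap.exists_threeUniformExpander (n := 192 * t) (m := 768 * t)
    (s := 192 * t / 1728 ^ 4) (c := 4) (by norm_num) (by omega) (by omega)
    (by rw [show (432 * 4 : ℕ) = 1728 by norm_num]; exact Nat.div_mul_le_self _ _)
  -- split into blocks of 48 occurrences
  let V := SplitVar F 48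
  let S : Fin (768 * t) → Finset V := splitScope F 48
  have hS3 : ∀ u, (S u).card = 3 := fun u => by rw [card_splitScope, hF3]
  have hdegS : ∀ x : V, (Finset.univ.filter fun u => x ∈ S u).card ≤ 48 :=
    fun x => splitDeg_le F 48 (by norm_num) x
  have hcardV : Fintype.card V ≤ 240 * t := by
    show Fintype.card (SplitVar F 48) ≤ 240 * t
    have h := card_splitVar_le F 48 (by norm_num : 0 < 48)
    have hsum : ∑ u, (F u).card = 3 * (768 * t) := by
      rw [Finset.sum_congr rfl fun u _ => hF3 u, Finset.sum_const, Finset.card_univ,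
        Fintype.card_fin, smul_eq_mul, mul_comm]
    rw [hsum] at h
    omega
  have hcardV' : 192 * t ≤ Fintype.card V := le_card_splitVar F 48
  -- far right-hand sides
  obtain ⟨b₂, hb₂⟩ := exists_far (p := 2) S (48 * t + 1) (far_ineq le_rfl ht1 hcardV)
  obtain ⟨b₃, hb₃⟩ := exists_far (p := 3) S (48 * t + 1) (far_ineq (by norm_num) ht1 hcardV)
  -- mixing permutations
  have hzN : t + 1 ≤ Fintype.card V := by omega
  obtain ⟨π, hπ⟩ := exists_mixing (V := V) (t + 1) 115200 (by omega)
    (mixing_ineq (by omega) hzN (by omega))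
  let G : V → V → Prop := fun v w => ∃ l, π l v = w
  refine ⟨V, inferInstance, inferInstance, S, b₂, b₃, G, inferInstance, hcardV', hcardV, hS3,
    fun T hT => ?_, fun v => ?_, fun w => ?_,
    fun Z hZ x => robust_of_far S hdegS (by omega) hb₂ Z hZ x,
    fun Z hZ x => robust_of_far S hdegS (by omega) hb₃ Z hZ x,
    fun Z Z' hZ hZ' => ?_⟩
  · exact Xor3Gap.card_le_two_mul_card_boundary S T (fun u _ => hS3 u)
      ((hFexp T hT).trans (Nat.mul_le_mul_left 4 (card_biUnion_le_card_biUnion_split F 48 T)))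
  · calc (Finset.univ.filter fun w => G v w).card = (Finset.univ.image fun l => π l v).card := by
          congr 1; ext w; simp [G]
      _ ≤ (Finset.univ : Finset (Fin 115200)).card := Finset.card_image_le
      _ = 115200 := by rw [Finset.card_univ, Fintype.card_fin]
  · calc (Finset.univ.filter fun v => G v w).card = (Finset.univ.image fun l => (π l).symm w).card := by
          congr 1; ext v
          simp only [G, Finset.mem_filter, Finset.mem_univ, true_and, Finset.mem_image]
          constructor
          · rintro ⟨l, hl⟩; exact ⟨l, by rw [← hl, Equiv.symm_apply_apply]⟩
          · rintro ⟨l, hl⟩; exact ⟨l, by rw [← hl, Equiv.apply_symm_apply]⟩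
      _ ≤ (Finset.univ : Finset (Fin 115200)).card := Finset.card_image_le
      _ = 115200 := by rw [Finset.card_univ, Fintype.card_fin]
  · obtain ⟨v, hv, w, hw, l, hl⟩ := hπ Z Z' hZ hZ'
    exact ⟨v, hv, w, hw, l, hl⟩

end Assembly

end SparseOrData

end Literature.ModelTheory.FiniteModelTheory
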